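import Summits.Ventures.QEC.Census.CertCoverAssembly
import HarnessLib

/-!
# Cover reduction — PRODUCERS of the assembly hypotheses from Bool tables (qec lane ε, type-10 side)

`CertCoverAssembly` (T0 `noBadOver_of_levelLabel`, T1 `flat_of_cover` / `flat_of_cover'`, T2 `cov_of_levels`) is
parametric in a handful of Prop-valued hypotheses. This file produces the ones that are NOT level verdicts from small
Bool tables, so that a per-code certificate file is left with `decide`s plus the quotient code's own flat distance
theorem:

* `exists_words_of_synZero` — **word-form L1**: from type-10's core structural verdict `bzCoreOK` (rank certificates,
  pairing, `n = r_X + r_Z + k`) and `wordsLtOK`, every `v < 2^n` with `H^X v = 0` is `xorSel HZ w ⊕ xorSel LZ w'`;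
* `pushKer_of_core` — hypothesis `hpushKer` of `cov_of_levels` from `kernelGensOK` / `annihilatesOK`
  (CertCoverChecks `push_of_gens`);
* `push2GensOK` / `span2_of_core` — hypothesis `hspan2` of `cov_of_levels` from a DOUBLE-PUSH TABLE (`P₂ (P₁ g)` of
  every generator `g ∈ HZ ++ LZ` as a stated selection of the level-2 generator list `Gb2`);
* `noBadOver_zero_of_quotient` — hypothesis `hzero` of `flat_of_cover` (**the `u = 0` case**): a bad word with
  `P v = 0` is a pull-back `P* y` of a bad word `y` of the QUOTIENT code with `|v| = 2|y|` (push table `pushRowsOK`,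
  pull table `pullRowsOK` of CertCoverSyndrome), so the quotient code's flat distance theorem (`Wq < |y|`, e.g. BB144's
  `twelve_le` for `[[288,12,18]] → [[144,12,12]]`, `Wq = 11`, `W = 16 < 24`) closes it;
* adapters `noBadOver_getD_of_forall` (list form ⇒ indexed `hreps`) and `flat_word_of_flat_vec` (vector statement ⇒
  word statement, converse of `flat_vec_of_flat_word`).

HONEST FRAMING: generic; everything proved; tier KERNEL, axioms standard; no data, no instances, no notation.
-/

namespace Summit.Ventures.QEC.Census

open Matrix Literature.InformationTheory.QuantumCodes

/-! ## Word bounds and word-form L1 -/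

/-- All listed words are below `2^n`. (definition) -/
def wordsLtOK (n : ℕ) (L : List ℕ) : Bool := L.all fun g => decide (g < 2 ^ n)

/-- Reading `wordsLtOK`. -/
theorem lt_of_wordsLtOK {n : ℕ} {L : List ℕ} (h : wordsLtOK n L = true) : ∀ g ∈ L, g < 2 ^ n := by
  simp only [wordsLtOK, List.all_eq_true, decide_eq_true_eq] at h
  exact h

/-- **Word-form L1**: with the core structural verdict (`bzCoreOK`: rank certificates, pairing, `n = r_X + r_Z + k`)
every word `v < 2^n` with `H^X v = 0` IS a stabilizer-row selection XOR a logical selection,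
`v = xorSel HZ w ⊕ xorSel LZ w'` (CertLogical `exists_coeffs_of_ker` read back on words). -/
theorem exists_words_of_synZero {n : ℕ} {HX HZ LZ LXd : List ℕ} {rcX rcZ : RankCert} {ew : Option (List ℕ)}
    (hcomm : rowMatrix n HX * (rowMatrix n HZ)ᵀ = 0) (hcore : bzCoreOK n HX HZ rcX rcZ LZ LXd ew = true)
    (hbd : wordsLtOK n (HZ ++ LZ) = true) {v : ℕ} (hv : v < 2 ^ n) (hsyn : synZero n HX v = true) :
    ∃ w w' : ℕ, v = xorSel HZ w ^^^ xorSel LZ w' := by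
  have hcore' := hcore
  simp only [bzCoreOK, Bool.and_eq_true, beq_iff_eq] at hcore'
  obtain ⟨⟨⟨⟨hY, hS⟩, hL⟩, hdim⟩, -⟩ := hcore'
  have hz : rowMatrix n HX *ᵥ ofBits n v = 0 := (synZero_iff _ _ _).1 hsyn
  obtain ⟨a, ha⟩ := exists_coeffs_of_ker hcomm hY hS hL hdim hz
  obtain ⟨w, hw⟩ := exists_xorSel_of_mem_rowSpace ha
  have hl : ∑ i, a i • logVec n LZ i ∈ rowSpace (rowMatrix n LZ) := by
    rw [rowSpace_rowMatrix_eq_span]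
    exact Submodule.sum_mem _ fun i _ => Submodule.smul_mem _ _ (Submodule.subset_span ⟨i, rfl⟩)
  obtain ⟨w', hw'⟩ := exists_xorSel_of_mem_rowSpace hl
  have hbd' := lt_of_wordsLtOK hbd
  refine ⟨w, w', ofBits_inj' hv (Nat.xor_lt_two_pow
    (xorSel_lt n HZ (fun g hg => hbd' g (List.mem_append_left _ hg)) w)
    (xorSel_lt n LZ (fun g hg => hbd' g (List.mem_append_right _ hg)) w')) ?_⟩
  rw [ofBits_xor, hw, hw', sub_add_cancel]

/-! ## `hpushKer` and `hspan2` of `cov_of_levels` -/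

/-- **`hpushKer` from tables**: word-form L1 + the two generator tables of `push_of_gens` (CertCoverChecks) ⇒ every
`v ∈ ker H^X` upstairs has `P v ∈ ker Hq` and every functional of `Λ` even on `P v` — hypothesis `hpushKer` of
`cov_of_levels`. -/
theorem pushKer_of_core {c : Cover2} {HX HZ Hq Lam LZ LXd : List ℕ} {rcX rcZ : RankCert} {ew : Option (List ℕ)}
    (hcomm : rowMatrix c.n HX * (rowMatrix c.n HZ)ᵀ = 0) (hcore : bzCoreOK c.n HX HZ rcX rcZ LZ LXd ew = true)
    (hbd : wordsLtOK c.n (HZ ++ LZ) = true) (hk : kernelGensOK c Hq (HZ ++ LZ) = true)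
    (ha : annihilatesOK c Lam (HZ ++ LZ) = true) :
    ∀ v : ℕ, v < 2 ^ c.n → synZero c.n HX v = true →
      synZero c.nq Hq (c.push v) = true ∧ ∀ l ∈ Lam, popc c.nq (l &&& c.push v) % 2 = 0 := by
  intro v hv hsyn
  obtain ⟨w, w', rfl⟩ := exists_words_of_synZero hcomm hcore hbd hv hsyn
  exact push_of_gens hk ha w w'

/-- DOUBLE-PUSH TABLE: the double push-forward `P₂ (P₁ g)` of the `i`-th listed generator `g` is the stated selection
`coef[i]` of the level-2 generator list `Gb2`. (definition) -/
def push2GensOK (c c₂ : Cover2) (gens Gb2 coef : List ℕ) : Bool :=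
  (List.range gens.length).all fun i => xorSel Gb2 (coef.getD i 0) == c₂.push (c.push (gens.getD i 0))

/-- **`hspan2` from tables**: word-form L1 + the double-push table ⇒ `P₂ (P₁ v) ∈ rowspace Gb2` for every
`v ∈ ker H^X` upstairs — hypothesis `hspan2` of `cov_of_levels`. -/
theorem span2_of_core {c c₂ : Cover2} {HX HZ LZ LXd Gb2 coef : List ℕ} {rcX rcZ : RankCert} {ew : Option (List ℕ)}
    (hcomm : rowMatrix c.n HX * (rowMatrix c.n HZ)ᵀ = 0) (hcore : bzCoreOK c.n HX HZ rcX rcZ LZ LXd ew = true)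
    (hbd : wordsLtOK c.n (HZ ++ LZ) = true) (ht : push2GensOK c c₂ (HZ ++ LZ) Gb2 coef = true) :
    ∀ v : ℕ, v < 2 ^ c.n → synZero c.n HX v = true →
      ofBits c₂.nq (c₂.push (c.push v)) ∈ rowSpace (rowMatrix c₂.nq Gb2) := by
  have hmem : ∀ x ∈ HZ ++ LZ, ofBits c₂.nq (c₂.push (c.push x)) ∈ rowSpace (rowMatrix c₂.nq Gb2) := by
    intro x hx
    obtain ⟨i, hi, rfl⟩ := List.getElem_of_mem hx
    simp only [push2GensOK, List.all_eq_true, List.mem_range, beq_iff_eq] at ht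
    have e := ht i hi
    have e' : (HZ ++ LZ).getD i 0 = (HZ ++ LZ)[i] := by
      rw [List.getD_eq_getElem?_getD, List.getElem?_eq_getElem hi, Option.getD_some]
    rw [e'] at e
    rw [← e]
    exact ofBits_xorSel_mem_rowSpace _ _ _
  have hsel : ∀ L : List ℕ, (∀ x ∈ L, x ∈ HZ ++ LZ) → ∀ m : ℕ,
      ofBits c₂.nq (c₂.push (c.push (xorSel L m))) ∈ rowSpace (rowMatrix c₂.nq Gb2) := by
    intro L hL m
    rw [Cover2.push_xorSel, Cover2.push_xorSel]
    refine ofBits_xorSel_mem_of_forall _ _ (fun x hx => ?_) m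
    rw [List.mem_map] at hx
    obtain ⟨y, hy, rfl⟩ := hx
    rw [List.mem_map] at hy
    obtain ⟨g, hg, rfl⟩ := hy
    exact hmem g (hL g hg)
  intro v hv hsyn
  obtain ⟨w, w', rfl⟩ := exists_words_of_synZero hcomm hcore hbd hv hsyn
  rw [Cover2.push_xor, Cover2.push_xor, ofBits_xor]
  exact Submodule.add_mem _ (hsel HZ (fun x hx => List.mem_append_left _ hx) w)
    (hsel LZ (fun x hx => List.mem_append_right _ hx) w')

/-! ## The `u = 0` case (`hzero` of `flat_of_cover`) -/

/-- `lift₀ 0 = 0`. -/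
theorem Cover2.lift0_zero (c : Cover2) : c.lift0 0 = 0 := by
  apply Nat.eq_of_testBit_eq; intro q
  rw [Nat.zero_testBit]
  by_cases hq : q < c.n
  · rw [c.testBit_lift0 hq, Nat.zero_testBit, Bool.and_false]
  · exact Nat.testBit_lt_two_pow (lt_of_lt_of_le (c.lift0_lt 0) (Nat.pow_le_pow_right (by norm_num) (Nat.not_lt.1 hq)))

/-- `P*` only reads the bits of `y` below `nq`: words with the same vector have the same pull-back. -/
theorem Cover2.pull_congr {c : Cover2} (hc : c.ok = true) {y y' : ℕ} (h : ofBits c.nq y = ofBits c.nq y') :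
    c.pull y = c.pull y' := by
  apply Nat.eq_of_testBit_eq; intro q
  by_cases hq : q < c.n
  · rw [c.testBit_pull hq, c.testBit_pull hq]
    have e := congrFun h ⟨c.Q q, Cover2.Q_lt hc hq⟩
    simp only [ofBits] at e
    revert e
    cases y.testBit (c.Q q) <;> cases y'.testBit (c.Q q) <;> simp
  · rw [Nat.testBit_lt_two_pow (lt_of_lt_of_le (c.pull_lt y) (Nat.pow_le_pow_right (by norm_num) (Nat.not_lt.1 hq))),
      Nat.testBit_lt_two_pow (lt_of_lt_of_le (c.pull_lt y') (Nat.pow_le_pow_right (by norm_num) (Nat.not_lt.1 hq)))]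

/-- **The `u = 0` case = the quotient code's own distance theorem.** A bad word `v` with `P v = 0` is a pull-back
`v = P* y` (`decomp`, `y := ypart v`); `y` has zero `Hq`-syndrome (push table: every small row has a sheet-0 row over
it), `y ∉ rowspace H̄^Z` (pull table: `P*` maps `rowspace H̄^Z` into `rowspace H^Z`), and `|v| = 2 |y|`. So if the
quotient code has no bad word of weight `≤ Wq` and `W < 2 (Wq + 1)`, no bad word of weight `≤ W` pushes forward to `0`
— hypothesis `hzero` of `flat_of_cover` (for `[[288,12,18]] → [[144,12,12]]`: `Wq = 11`, `W = 16 < 24`). -/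
theorem noBadOver_zero_of_quotient {c cr crZ : Cover2} (hc : c.ok = true) (hcr : cr.ok = true)
    {HX HZ Hq HZq : List ℕ} (hrows : pushRowsOK c cr HX Hq = true) (hpull : pullRowsOK c crZ HZq HZ = true)
    {W Wq : ℕ} (hW : W < 2 * (Wq + 1))
    (hlow : ∀ y : ℕ, y < 2 ^ c.nq → synZero c.nq Hq y = true → ofBits c.nq y ∉ rowSpace (rowMatrix c.nq HZq) →
      Wq < popc c.nq y) :
    NoBadOver c HX HZ W 0 := by
  intro v hv hsyn hnot hwt hpush
  have hlen : cr.n = HX.length ∧ cr.nq = Hq.length := by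
    simp only [pushRowsOK, Bool.and_eq_true, beq_iff_eq] at hrows
    exact ⟨hrows.1.1, hrows.1.2⟩
  -- `v = P* y` with `y := ypart v`
  have hdec : c.pull (c.ypart v) = v := by
    have := Cover2.decomp hc hv
    rwa [hpush, Cover2.lift0_zero, Nat.zero_xor] at this
  -- `y` has zero syndrome downstairs
  have hsynq : synZero c.nq Hq (c.ypart v) = true := by
    refine synZero_of_synBit fun rb hrb => ?_
    have hrb' : rb < cr.nq := hlen.2 ▸ hrb
    have hr : cr.F0 rb < HX.length := hlen.1 ▸ Cover2.F0_lt hcr hrb'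
    have h0 := synBit_of_synZero hsyn hr
    rwa [← hdec, synBit_pull hc hrows hr, Cover2.Q_F0 hcr hrb'] at h0
  -- `y` is not a stabilizer downstairs
  have hnotq : ofBits c.nq (c.ypart v) ∉ rowSpace (rowMatrix c.nq HZq) := by
    intro hmem
    obtain ⟨m, hm⟩ := exists_xorSel_of_mem_rowSpace hmem
    apply hnot
    rw [← hdec, ← Cover2.pull_congr hc hm]
    exact ofBits_pull_xorSel_mem hpull m
  -- weights: `|v| = 2 |y|`
  have hy := hlow _ (c.ypart_lt v) hsynq hnotq
  have h2 : popc c.n (c.pull (c.ypart v)) = 2 * popc c.nq (c.ypart v) := Cover2.popc_pull hc _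
  rw [hdec] at h2
  omega

/-! ## Adapters -/

/-- Representatives given as a list with a proof per member ⇒ the indexed form `hreps` of `flat_of_cover`. -/
theorem noBadOver_getD_of_forall {c : Cover2} {HX HZ : List ℕ} {W : ℕ} {reps : List ℕ}
    (h : ∀ u ∈ reps, NoBadOver c HX HZ W u) : ∀ j : ℕ, j < reps.length → NoBadOver c HX HZ W (reps.getD j 0) := by
  intro j hj
  rw [List.getD_eq_getElem?_getD, List.getElem?_eq_getElem hj, Option.getD_some]
  exact h _ (List.getElem_mem hj)

/-- The converse adapter of `flat_vec_of_flat_word`: a flat distance statement about VECTORS (as census / route files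
state it, e.g. BB144's `twelve_le` after `omega`) gives the word form `hlow` of `noBadOver_zero_of_quotient`. -/
theorem flat_word_of_flat_vec {n : ℕ} {HX HZ : List ℕ} {W : ℕ}
    (h : ∀ w : Fin n → ZMod 2, rowMatrix n HX *ᵥ w = 0 → w ∉ rowSpace (rowMatrix n HZ) → W < hammingNorm w) :
    ∀ v : ℕ, v < 2 ^ n → synZero n HX v = true → ofBits n v ∉ rowSpace (rowMatrix n HZ) → W < popc n v := by
  intro v _ hsyn hnot
  rw [← hammingNorm_ofBits]
  exact h _ ((synZero_iff _ _ _).1 hsyn) hnot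


/-! ## Adapters for large `n`: tables from per-index facts and the core verdict from its parts (nothing evaluated) -/

/-- `autsCompatOK` from per-index facts (for `n` where one `decide` over the `n²`-size row maps is too dear). -/
theorem autsCompatOK_of_forall {c : Cover2} {HX HZ : List ℕ} {perms permqs rowsX rowsZ : List (List ℕ)}
    (hlen : permqs.length = perms.length)
    (h : ∀ i : ℕ, i < perms.length →
      c.permCompatOK (perms.getD i []) (permqs.getD i []) = true ∧
        rowMapOK c.n HX (perms.getD i []) (rowsX.getD i []) = true ∧
        rowMapOK c.n HZ (perms.getD i []) (rowsZ.getD i []) = true) :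
    autsCompatOK c HX HZ perms permqs rowsX rowsZ = true := by
  simp only [autsCompatOK, Bool.and_eq_true, beq_iff_eq, List.all_eq_true, List.mem_range]
  exact ⟨hlen.symm, fun i hi => ⟨⟨(h i hi).1, (h i hi).2.1⟩, (h i hi).2.2⟩⟩

/-- The same from the FAST lockstep row-map checks `rowMapOKL` (BZAutPermFast; `permListOK` is read off
`permCompatOK`). -/
theorem autsCompatOK_of_forallL {c : Cover2} {HX HZ : List ℕ} {perms permqs rowsX rowsZ : List (List ℕ)}
    (hlen : permqs.length = perms.length)
    (h : ∀ i : ℕ, i < perms.length →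
      c.permCompatOK (perms.getD i []) (permqs.getD i []) = true ∧
        rowMapOKL HX (perms.getD i []) (rowsX.getD i []) = true ∧
        rowMapOKL HZ (perms.getD i []) (rowsZ.getD i []) = true) :
    autsCompatOK c HX HZ perms permqs rowsX rowsZ = true := by
  refine autsCompatOK_of_forall hlen fun i hi => ?_
  obtain ⟨hc, hX, hZ⟩ := h i hi
  have hperm : permListOK c.n (perms.getD i []) = true := by
    simp only [Cover2.permCompatOK, Bool.and_eq_true] at hc; exact hc.1.1
  exact ⟨hc, rowMapOK_of_rowMapOKL hperm hX, rowMapOK_of_rowMapOKL hperm hZ⟩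

/-- `autsCompat2OK` from per-index facts. -/
theorem autsCompat2OK_of_forall {c c₂ : Cover2} {HX HZ : List ℕ} {perms permqs permqqs rowsX rowsZ : List (List ℕ)}
    (hlen : permqs.length = perms.length) (hlen₂ : permqqs.length = perms.length)
    (h : ∀ i : ℕ, i < perms.length →
      c.permCompatOK (perms.getD i []) (permqs.getD i []) = true ∧
        c₂.permCompatOK (permqs.getD i []) (permqqs.getD i []) = true ∧
        rowMapOK c.n HX (perms.getD i []) (rowsX.getD i []) = true ∧
        rowMapOK c.n HZ (perms.getD i []) (rowsZ.getD i []) = true) :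
    autsCompat2OK c c₂ HX HZ perms permqs permqqs rowsX rowsZ = true := by
  simp only [autsCompat2OK, Bool.and_eq_true, beq_iff_eq, List.all_eq_true, List.mem_range]
  exact ⟨⟨hlen.symm, hlen₂.symm⟩, fun i hi => ⟨⟨⟨(h i hi).1, (h i hi).2.1⟩, (h i hi).2.2.1⟩, (h i hi).2.2.2⟩⟩

/-- The same from the fast row-map checks. -/
theorem autsCompat2OK_of_forallL {c c₂ : Cover2} {HX HZ : List ℕ} {perms permqs permqqs rowsX rowsZ : List (List ℕ)}
    (hlen : permqs.length = perms.length) (hlen₂ : permqqs.length = perms.length)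
    (h : ∀ i : ℕ, i < perms.length →
      c.permCompatOK (perms.getD i []) (permqs.getD i []) = true ∧
        c₂.permCompatOK (permqs.getD i []) (permqqs.getD i []) = true ∧
        rowMapOKL HX (perms.getD i []) (rowsX.getD i []) = true ∧
        rowMapOKL HZ (perms.getD i []) (rowsZ.getD i []) = true) :
    autsCompat2OK c c₂ HX HZ perms permqs permqqs rowsX rowsZ = true := by
  refine autsCompat2OK_of_forall hlen hlen₂ fun i hi => ?_
  obtain ⟨hc, hc₂, hX, hZ⟩ := h i hi
  have hperm : permListOK c.n (perms.getD i []) = true := by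
    simp only [Cover2.permCompatOK, Bool.and_eq_true] at hc; exact hc.1.1
  exact ⟨hc, hc₂, rowMapOK_of_rowMapOKL hperm hX, rowMapOK_of_rowMapOKL hperm hZ⟩

/-- The core structural verdict from its parts (rank certificates may come chunked — `RankCertChunks.check_of_chunks`
— and the pairing from a fast twin — `logOK_of_logOKQ` / `logOK_of_cols`; no parity witness). -/
theorem bzCoreOK_of_parts {n : ℕ} {Hsyn Hstab L Ld : List ℕ} {rcY rcS : RankCert} (hY : rcY.check n Hsyn = true)
    (hS : rcS.check n Hstab = true) (hL : logOK n Hsyn Hstab L Ld = true) (hdim : n = rcY.r + rcS.r + L.length) :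
    bzCoreOK n Hsyn Hstab rcY rcS L Ld none = true := by
  simp only [bzCoreOK, hY, hS, hL, parityPartOK, Bool.true_and, Bool.and_true, beq_iff_eq]
  exact hdim

/-- Every row of `H^Z` is a kernel word of `H^X` — from the commutation identity, NOT by evaluating popcounts. -/
theorem synZero_of_mem_of_comm {n : ℕ} {HX HZ : List ℕ} (hcomm : rowMatrix n HX * (rowMatrix n HZ)ᵀ = 0) {r : ℕ}
    (hr : r ∈ HZ) : synZero n HX r = true := by
  obtain ⟨i, hi, rfl⟩ := List.getElem_of_mem hr
  rw [synZero_iff]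
  have e : rowMatrix n HX *ᵥ ofBits n HZ[i] = fun j => (rowMatrix n HX * (rowMatrix n HZ)ᵀ) j ⟨i, hi⟩ := by
    funext j
    simp only [Matrix.mulVec, dotProduct, Matrix.mul_apply, Matrix.transpose_apply, rowMatrix, Fin.getElem_fin]
  rw [e, hcomm]
  rfl

/-- Subadditivity of the weight under XOR (via the Hamming triangle inequality). -/
private theorem popc_xor_le_aux (n a b : ℕ) : popc n (a ^^^ b) ≤ popc n a + popc n b := by
  rw [← hammingNorm_ofBits, ← hammingNorm_ofBits, ← hammingNorm_ofBits, ofBits_xor]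
  have e : ofBits n a + ofBits n b = -ofBits n a + ofBits n b := by
    funext j
    simp only [Pi.add_apply, Pi.neg_apply]
    generalize ofBits n a j = x
    generalize ofBits n b j = y
    revert x y
    decide
  rw [e, ← hammingDist_eq_hammingNorm]
  calc hammingDist (ofBits n a) (ofBits n b)
      ≤ hammingDist (ofBits n a) 0 + hammingDist 0 (ofBits n b) := hammingDist_triangle _ _ _
    _ = hammingNorm (ofBits n a) + hammingNorm (ofBits n b) := by rw [hammingDist_zero_right, hammingDist_zero_left]

/-- **A representative that is the push-forward of a stabilizer row** (the `H̄^Z`-row shortcut): if no bad word of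
weight `≤ W'` pushes to `0` and `r` is a stabilizer-row word with `W + |r| ≤ W'`, then no bad word of weight `≤ W`
pushes to `P r` — for `v ↦ v ⊕ r` is bad again, of weight `≤ W + |r|`, and pushes to `0`. (For `[[288,12,18]]`: `|r| = 6`,
`W = 16`, `W' = 22 < 24`.) -/
theorem noBadOver_push_of_zero {c : Cover2} {HX HZ : List ℕ} {W W' r : ℕ}
    (hcomm : rowMatrix c.n HX * (rowMatrix c.n HZ)ᵀ = 0) (hz : NoBadOver c HX HZ W' 0) (hr : r ∈ HZ)
    (hrlt : r < 2 ^ c.n) (hW : W + popc c.n r ≤ W') : NoBadOver c HX HZ W (c.push r) := by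
  intro v hv hsyn hnot hwt hpush
  have hrker := synZero_of_mem_of_comm hcomm hr
  refine hz (v ^^^ r) (Nat.xor_lt_two_pow hv hrlt) ?_ ?_ ?_ ?_
  · refine synZero_of_synBit fun i hi => ?_
    rw [synBit_xor, synBit_of_synZero hsyn hi, synBit_of_synZero hrker hi]
    rfl
  · intro h
    apply hnot
    obtain ⟨i, hi, e⟩ := List.getElem_of_mem hr
    have hrm : ofBits c.n r ∈ rowSpace (rowMatrix c.n HZ) := by
      rw [← e, rowSpace_rowMatrix_eq_span]
      exact Submodule.subset_span ⟨⟨i, hi⟩, rfl⟩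
    have e' : ofBits c.n (v ^^^ r) + ofBits c.n r = ofBits c.n v := by
      rw [← ofBits_xor, Nat.xor_assoc, Nat.xor_self, Nat.xor_zero]
    have := Submodule.add_mem _ h hrm
    rwa [e'] at this
  · exact le_trans (popc_xor_le_aux _ _ _) (le_trans (Nat.add_le_add_right hwt _) hW)
  · rw [Cover2.push_xor, hpush, Nat.xor_self]

/-! ## One-level instances, linear witness coverage, and the quotient row as a census theorem -/

/-- **Witness coverage without the quadratic check**: if the witness table lists exactly the words (in order), every
word is covered — an `O(1)`-size proof, nothing evaluated (use instead of `decide` on `coveredOK` for large tables). -/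
theorem coveredOK_of_map_eq {words : List ℕ} {tab : List CoverWitness} (h : tab.map CoverWitness.w = words) :
    coveredOK words tab = true := by
  subst h
  simp only [coveredOK, List.all_eq_true, List.any_eq_true, beq_iff_eq, List.mem_map]
  rintro w ⟨t, ht, rfl⟩
  exact ⟨t, ht, rfl⟩

/-- SINGLE-PUSH TABLE: the push-forward `P g` of the `i`-th listed generator `g` is the stated selection `coef[i]` of
the level-1 generator list `Gb` (generators of `C_M = P (ker H^X)` as words). (definition) -/
def push1GensOK (c : Cover2) (gens Gb coef : List ℕ) : Bool :=
  (List.range gens.length).all fun i => xorSel Gb (coef.getD i 0) == c.push (gens.getD i 0)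

/-- **`hspan1` from tables** (one-level certificates): word-form L1 + the single-push table ⇒ `P v ∈ rowspace Gb`
for every `v ∈ ker H^X`. -/
theorem span1_of_core {c : Cover2} {HX HZ LZ LXd Gb coef : List ℕ} {rcX rcZ : RankCert} {ew : Option (List ℕ)}
    (hcomm : rowMatrix c.n HX * (rowMatrix c.n HZ)ᵀ = 0) (hcore : bzCoreOK c.n HX HZ rcX rcZ LZ LXd ew = true)
    (hbd : wordsLtOK c.n (HZ ++ LZ) = true) (ht : push1GensOK c (HZ ++ LZ) Gb coef = true) :
    ∀ v : ℕ, v < 2 ^ c.n → synZero c.n HX v = true → ofBits c.nq (c.push v) ∈ rowSpace (rowMatrix c.nq Gb) := by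
  have hmem : ∀ x ∈ HZ ++ LZ, ofBits c.nq (c.push x) ∈ rowSpace (rowMatrix c.nq Gb) := by
    intro x hx
    obtain ⟨i, hi, rfl⟩ := List.getElem_of_mem hx
    simp only [push1GensOK, List.all_eq_true, List.mem_range, beq_iff_eq] at ht
    have e := ht i hi
    have e' : (HZ ++ LZ).getD i 0 = (HZ ++ LZ)[i] := by
      rw [List.getD_eq_getElem?_getD, List.getElem?_eq_getElem hi, Option.getD_some]
    rw [e'] at e
    rw [← e]
    exact ofBits_xorSel_mem_rowSpace _ _ _
  have hsel : ∀ L : List ℕ, (∀ x ∈ L, x ∈ HZ ++ LZ) → ∀ m : ℕ,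
      ofBits c.nq (c.push (xorSel L m)) ∈ rowSpace (rowMatrix c.nq Gb) := by
    intro L hL m
    rw [Cover2.push_xorSel]
    refine ofBits_xorSel_mem_of_forall _ _ (fun x hx => ?_) m
    rw [List.mem_map] at hx
    obtain ⟨g, hg, rfl⟩ := hx
    exact hmem g (hL g hg)
  intro v hv hsyn
  obtain ⟨w, w', rfl⟩ := exists_words_of_synZero hcomm hcore hbd hv hsyn
  rw [Cover2.push_xor, ofBits_xor]
  exact Submodule.add_mem _ (hsel HZ (fun x hx => List.mem_append_left _ hx) w)
    (hsel LZ (fun x hx => List.mem_append_right _ hx) w')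

/-- **One-level candidate cover** (`hcov` of `flat_of_cover` for a ONE-level certificate): `P v ∈ rowspace Gb` for
every kernel word (`span1_of_core`) and a complete list of the nonzero words of `rowspace Gb` of weight `≤ W`
(`CertBZList.mem_allow_of_bz_list`) ⇒ every bad word of weight `≤ W` pushes to `0` or into the list. -/
theorem cov_of_list1 {c : Cover2} (hc : c.ok = true) {HX HZ Gb found : List ℕ} {W : ℕ}
    (hspan : ∀ v : ℕ, v < 2 ^ c.n → synZero c.n HX v = true → ofBits c.nq (c.push v) ∈ rowSpace (rowMatrix c.nq Gb))
    (hl : ∀ s : ℕ, s < 2 ^ c.nq → ofBits c.nq s ∈ rowSpace (rowMatrix c.nq Gb) → s ≠ 0 → popc c.nq s ≤ W → s ∈ found) :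
    ∀ v : ℕ, BadLe c HX HZ W v → c.push v = 0 ∨ c.push v ∈ found := by
  rintro v ⟨hv, hsyn, -, hwt⟩
  by_cases h0 : c.push v = 0
  · exact Or.inl h0
  · exact Or.inr (hl _ (c.push_lt v) (hspan v hv hsyn) h0 (le_trans (Cover2.popc_push_le hc v) hwt))

/-- **The quotient's flat distance from its census row**: a census theorem `(c.code hc).IsCode N k d` of the quotient
certificate `c` gives the word form `d ≤ |y|` for every `y ∈ ker H̄^X ∖ rowspace H̄^Z` (then `hlow` of
`noBadOver_zero_of_quotient` with `Wq := d - 1` by `omega`). -/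
theorem flat_le_of_isCode (c : DistCert) (hc : commOK c.n c.HX c.HZ = true) {N k d : ℕ} (h : (c.code hc).IsCode N k d) :
    ∀ y : ℕ, y < 2 ^ c.n → synZero c.n c.HX y = true → ofBits c.n y ∉ rowSpace (rowMatrix c.n c.HZ) → d ≤ popc c.n y := by
  intro y _ hsyn hnot
  rw [← hammingNorm_ofBits]
  exact le_trans h.le_dX_and_le_dZ.2.1 ((c.code hc).dZ_le_hammingNorm ((synZero_iff _ _ _).1 hsyn) hnot)


/-! ## Candidate lists given per problem: union over `List.range N` -/

/-- Coverage of a union of per-problem candidate lists from per-problem coverage facts. -/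
theorem coveredOK_flatMap {f : ℕ → List ℕ} {tab : List CoverWitness} {N : ℕ}
    (h : ∀ j : ℕ, j < N → coveredOK (f j) tab = true) : coveredOK ((List.range N).flatMap f) tab = true := by
  simp only [coveredOK, List.all_eq_true, List.mem_flatMap, List.mem_range] at h ⊢
  rintro w ⟨j, hj, hw⟩
  exact h j hj w hw

/-- Membership in the union (the `hsub` hypothesis of `cov_of_levels` with `cand := (List.range N).flatMap cand2`). -/
theorem mem_flatMap_range {f : ℕ → List ℕ} {N : ℕ} : ∀ j : ℕ, j < N → ∀ u ∈ f j, u ∈ (List.range N).flatMap f :=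
  fun j hj _ hu => List.mem_flatMap.2 ⟨j, List.mem_range.2 hj, hu⟩

end Summit.Ventures.QEC.Census
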